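import Mathlib
import Literature.MathematicalPhysics.QuantumFieldTheory.BalabanImbrieJaffe1984to88.BIJ85Prop511Proof

/-!
# `BalabanImbrieJaffe1984to88.BIJ85FaddeevPopov518` — T. Bałaban, J. Imbrie, A. Jaffe, *Renormalization of the Higgs model:
minimizers, propagators and the stability of mean field theory*, Commun. Math. Phys. **97** (1985) 299–329
[BalabanImbrieJaffe1985]: the **Faddeev–Popov steps of the proof of Proposition 5.1.1**, p. 314 [PDF 16], as IDENTITIES OF
LEBESGUE/HAAR INTEGRALS over the constraint subspaces — part 1: the F–P unity, *"the gauge transformation A → A + ∂λ"* as a linear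
isomorphism `V × N(Q′) ≅ N(Q_k)` with its change-of-variables formula, and the integrability of the Gaussian integrands (file 3a of
row C1.Prop5.1.1; part 2 = `…BIJ85FaddeevPopov519`: (5.1.8), (5.1.9) and (5.1.1) re-derived; file 1 = `…BIJ85Prop511Proof`, file 2 =
`…BIJ85Prop511Torus`)

statement-level skeleton of published theorems with citation tags; proofs where landed; nothing here is a claim about the Yang–Mills mass gap

PDF held: `paper:balaban1985-cmp97-bij-higgs-minimizers` (journal page = PDF page + 298); p. 314 [PDF 16] read on the render
`run/shared/lean/pub/lit-balaban/lit-balaban-r15/pages/1985-cmp97-bij-higgs-minimizers-p016-x2.png` (displays exact) and the OCR text.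

CITATION HEADER (lean-in-tree rule).  Phase-2 proof seat p30 (gen 4) of `lit-balaban` (HOME `run/shared/lean/pub/lit-balaban/`, unit
`lit-balaban-p30-g4`); SKELETON rows **C1.Eq5.1.5-5.1.15** (cell «(5.1.5)–(5.1.9) FP/δ-function displays hypothesis-level only (no
disintegration measure in the tree)» — this file supplies them) and **C1.Prop5.1.1**.

THE PRINTED TEXT (p. 314, verbatim).  *"Proof. The definition of H_{k,Ax}B is H_{k,Ax}B = Z_{k,Ax}(B)⁻¹∫dAδ(Q_kA − B)δ_{k,Ax}(A)
exp(−½‖∂A‖²)A, (5.1.5) where δ_{k,Ax}(A) = Π_{j=0}^{k−1}δ_{Ax}(Q_jA). (5.1.6) Furthermore, H_kB = Z_k(B)⁻¹∫dAδ(Q_kA − B)𝒢(∂*A)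
exp(−½‖∂A‖²)A, (5.1.7) where 𝒢(∂*A) is a gauge fixing term, and where both integrals are normalized so that without the final
factor A they equal 1. We use a variant of the Faddeev-Popov procedure and insert the factor 1 in the integrand (5.1.5), expressed
as 1 = Z_k⁻¹∫dλδ(Q′_kλ)𝒢(∂*A − Δλ). Therefore, Z_{k,Ax}(B) = ∫dAδ(Q_kA − B)δ_{k,Ax}(A)exp(−½‖∂A‖²) = Z_k⁻¹∫dAdλ δ(Q′_kλ)𝒢(∂*A − Δλ)
δ(Q_kA − B)δ_{k,Ax}(A)exp(−½‖∂A‖²). Making the gauge transformation A → A + ∂λ, and using Q_kA → Q_kA + Q_k∂λ = Q_kA + ∂Q′_kλ = Q_kA,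
on account of the δ function yields Z_{k,Ax}(B) = Z_k⁻¹∫dA𝒢(∂*A)δ(Q_kA − B)exp(−½‖∂A‖²)∫dλ δ(Q′_kλ)δ_{k,Ax}(A + ∂λ) = Z_k⁻¹∫dA𝒢(∂*A)
δ(Q_kA − B)exp(−½‖∂A‖²) = Z_k⁻¹Z_k(B). (5.1.8) If we perform the same steps leading to (5.1.8) in (5.1.5), we obtain by (5.1.8)
H_{k,Ax}B = Z_k(B)⁻¹∫dAδ(Q_kA − B)𝒢(∂*A)exp(−½‖∂A‖²)·∫dλδ(Q′_kλ)δ_{k,Ax}(A + ∂λ)(A + ∂λ). (5.1.9) In order to evaluate (5.1.9), we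
solve the system of linear equations for λ which result from the delta functions δ(Q′_kλ) and δ_{k,Ax}(A + ∂λ). Using this value
of λ = λ(A), we have H_{k,Ax}B = Z_k(B)⁻¹∫dA δ(Q_kA − B)𝒢(∂*A)exp(−½‖∂A‖²)(A + ∂λ(A))."*

HOW THE δ-FUNCTIONS ARE READ (exactly as in the two minimizer files): `∫dA δ(Q_kA − B)δ_{k,Ax}(A)(…)` = the integral over the affine
class `A₀ + V`, `V = {Q_kA = 0} ∩ {δ_{k,Ax}}`, for the Lebesgue measure of `V` (p09's `Zax`/`Hax`, (4.1.3)–(4.1.4)); `∫dA δ(Q_kA −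
B)(…)` = the integral over the fibre `{Q_kA = B}` for the Lebesgue measure of `N(Q_k)` (p11's `fibInt`, `Zk`, `Hk`, (4.4.2)–(4.4.3));
`∫dλ δ(Q′_kλ)(…)` = the integral over `N(Q′_k)` for its Lebesgue measure (p11's `fpDen`/`cR`, (4.4.1), [6I] (1.40)); the gauge
fixing term is p11's `calG` = 𝒢 of (4.4.1).  The normalizing Jacobians of the δ-functions are not carried (as in p11's files): they
are the A- and B-INDEPENDENT constant `c` of `fp_change_of_variables` below (the printed `Z_k⁻¹` of (5.1.8), B-independent), and
they cancel in the quotients (5.1.9)/(4.1.3)/(4.4.2) — which is the content of (5.1.9).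
WHAT IS PROVED (setting and hypotheses = file 1: `LandauOps` D with `GaugeStructure grad`, axial subspace `Ax`, `V = {Q_k = 0} ∩ Ax`
(`hV`), the (5.1.13)-characterized linear gauge-function map `lam` (`hlamQ`, `hlamAx`, `hlamU`), no zero modes `hZ`, «Δ > 0 on
N(Q′)» `hL`):
* `fp_unity` — **the F–P unity of p. 314** with 𝒢 of (4.4.1): `∫_{N(Q′)} 𝒢(∂*(A + ∂μ)) dμ = 1` for EVERY `A` (so the printed `Z_k`
  of "1 = Z_k⁻¹∫dλ δ(Q′_kλ)𝒢(∂*A − Δλ)" is `1` for this 𝒢; [6I] (1.40): this is why 𝒢 has the form (4.4.1));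
* `exists_fpEquiv` — *"the gauge transformation A → A + ∂λ"*: `(A′, λ) ↦ A′ + ∂λ` is a LINEAR ISOMORPHISM `V × N(Q′) ≅ N(Q_k)`
  (injective by the uniqueness of λ, onto because `A − ∂λ(A)`… i.e. `A + ∂λ(A)` is axial), and `fp_change_of_variables` — the
  resulting change of variables `∫_{N(Q_k)} g(A₁ + v)dv = c·∫_V∫_{N(Q′)} g(A₁ + w + ∂μ)dμ dw` with ONE constant `c > 0` (Haar
  measure uniqueness on `N(Q_k)`; Fubini);
* `axialRep_add_grad` — `δ_{k,Ax}(A + ∂λ)` picks the axial representative: `(X + ∂μ) + ∂λ(X + ∂μ) = X + ∂λ(X)` for `μ ∈ N(Q′)`;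
* `integrable_weight_fibre`, `integrable_weight_smul_fibre` — integrability over `N(Q_k)` of the (4.4.3)/(4.4.2)/(5.1.9) integrands,
  at the base point `H_kB`, from p11's splitting `E(H_kB + v) = E(H_kB) + E(v)` and p09's Gaussian lemmas (`partition_integrable`,
  `moment_integrable`) for the injective map `v ↦ (∂v, R∂*v)` (private plumbing `Tmap`).
(5.1.8), (5.1.9) themselves and (5.1.1) re-derived: part 2, `…BIJ85FaddeevPopov519`.  Carrier clauses (F6): as in file 1.  The only
definition is the private plumbing map `Tmap` (no `def … : Prop`); axioms: the standard three.
-/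

namespace Literature.MathematicalPhysics.QuantumFieldTheory.BalabanImbrieJaffe1984to88.BIJ85FaddeevPopov518

open MeasureTheory
open scoped NNReal ENNReal
open Literature.MathematicalPhysics.QuantumFieldTheory.BalabanImbrieJaffe1984to88.BIJ85LandauForm441
open Literature.MathematicalPhysics.QuantumFieldTheory.BalabanImbrieJaffe1984to88.BIJ85LandauMinimizer442
open Literature.MathematicalPhysics.QuantumFieldTheory.BalabanImbrieJaffe1984to88.BIJ85AxialPropagator411 (partition_integrable)
open Literature.MathematicalPhysics.QuantumFieldTheory.BalabanImbrieJaffe1984to88.BIJ85AxialMinimizer413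
open Literature.MathematicalPhysics.QuantumFieldTheory.BalabanImbrieJaffe1984to88.BIJ85Prop511Proof

noncomputable section

variable {EA ES EP EB ES' : Type*}
  [NormedAddCommGroup EA] [InnerProductSpace ℝ EA] [FiniteDimensional ℝ EA] [MeasurableSpace EA] [BorelSpace EA]
  [NormedAddCommGroup ES] [InnerProductSpace ℝ ES] [FiniteDimensional ℝ ES] [MeasurableSpace ES] [BorelSpace ES]
  [NormedAddCommGroup EP] [InnerProductSpace ℝ EP]
  [AddCommGroup EB] [Module ℝ EB] [AddCommGroup ES'] [Module ℝ ES']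
  (D : LandauOps EA ES EP EB ES')

/-! ## §1  The Faddeev–Popov unity (p. 314) for the gauge fixing function 𝒢 of (4.4.1) -/

omit [FiniteDimensional ℝ EA] [MeasurableSpace EA] [BorelSpace EA] in
/-- **The Faddeev–Popov unity**, p. 314 [PDF 16], verbatim: *"We use a variant of the Faddeev-Popov procedure and insert the factor 1
in the integrand (5.1.5), expressed as 1 = Z_k⁻¹∫dλδ(Q′_kλ)𝒢(∂*A − Δλ)"* — for the gauge fixing function 𝒢 of (4.4.1) (p11's `calG`;
λ-integral = the integral over `N(Q′)` for its Lebesgue measure, [6I] (1.40)), `∫_{N(Q′)} 𝒢(∂*(A + ∂μ))dμ = 1` for EVERY field `A`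
(so `Z_k = 1` here): `𝒢(∂*(A + ∂μ)) = c_R⁻¹exp(−½‖R∂*A + Δμ‖²)` (`calG_eq`, `∂*∂μ = Δμ`, `RΔμ = Δμ`), `R∂*A = Δμ₀` with `μ₀ ∈ N(Q′)`,
and the Lebesgue measure of `N(Q′)` is translation invariant (input «Δ > 0 on N(Q′)» `hL`, [6I] p. 25, for `c_R > 0`).
[cite: BalabanImbrieJaffe1985, (5.1.7) p.314] -/
theorem fp_unity (hL : ∀ l : ES, D.Qp l = 0 → D.lap l = 0 → l = 0) {grad : ES →ₗ[ℝ] EA} (hg : D.GaugeStructure grad) (A : EA) :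
    ∫ μ : D.kerQp, calG D (D.dstar (A + grad (μ : ES))) = 1 := by
  obtain ⟨l0, hl0, hl0eq⟩ : ∃ l ∈ D.kerQp, D.lap l = D.projR (D.dstar A) :=
    Submodule.mem_map.mp (D.gaugeRange.starProjection_apply_mem (D.dstar A))
  set L0 : D.kerQp := ⟨l0, hl0⟩ with hL0
  have hpt : ∀ μ : D.kerQp, calG D (D.dstar (A + grad (μ : ES))) =
      (cR D)⁻¹ * Real.exp (-(1 / 2 : ℝ) * ‖D.lap ((L0 + μ : D.kerQp) : ES)‖ ^ 2) := by
    intro μ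
    rw [calG_eq, map_add, hg.dstar_grad, map_add, D.projR_lap_of_mem ((D.mem_kerQp).mp μ.2), ← hl0eq, Submodule.coe_add,
      map_add]
  simp_rw [hpt]
  rw [integral_const_mul]
  have htr := integral_add_left_eq_self (μ := (volume : Measure D.kerQp))
    (fun l : D.kerQp => Real.exp (-(1 / 2 : ℝ) * ‖D.lap (l : ES)‖ ^ 2)) L0
  rw [htr]
  exact inv_mul_cancel₀ (cR_pos D hL).ne'

omit [FiniteDimensional ℝ EA] [MeasurableSpace EA] [BorelSpace EA] in
/-- **The λ-integral of the Landau weight over a gauge orbit**: `∫_{N(Q′)} 𝒢(∂*(A + ∂μ))exp(−½‖∂(A + ∂μ)‖²)dμ = exp(−½‖∂A‖²)` (the F–P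
unity and the gauge invariance `∂∂μ = 0` of `‖∂A‖²` — the step *"Making the gauge transformation A → A + ∂λ … on account of the δ
function yields …"* of (5.1.8)). [cite: BalabanImbrieJaffe1985, (5.1.8) p.314] -/
theorem integral_weight_orbit (hL : ∀ l : ES, D.Qp l = 0 → D.lap l = 0 → l = 0) {grad : ES →ₗ[ℝ] EA} (hg : D.GaugeStructure grad)
    (A : EA) : ∫ μ : D.kerQp, weight D (A + grad (μ : ES)) = Real.exp (-(1 / 2 : ℝ) * ‖D.curl A‖ ^ 2) := by
  have hpt : ∀ μ : D.kerQp, weight D (A + grad (μ : ES)) =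
      calG D (D.dstar (A + grad (μ : ES))) * Real.exp (-(1 / 2 : ℝ) * ‖D.curl A‖ ^ 2) := by
    intro μ
    have hc : D.curl (A + grad (μ : ES)) = D.curl A := by rw [map_add, hg.curl_grad, add_zero]
    rw [weight, hc]
  simp_rw [hpt]
  rw [integral_mul_const, fp_unity D hL hg A, one_mul]

/-! ## §2  The gauge function under gauge transformations: `δ_{k,Ax}(A + ∂λ)` picks the axial representative -/

omit [FiniteDimensional ℝ EA] [MeasurableSpace EA] [BorelSpace EA] [FiniteDimensional ℝ ES] [MeasurableSpace ES] [BorelSpace ES] in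
/-- `λ(X + ∂μ) = λ(X) − μ` for `μ ∈ N(Q′)` (uniqueness of the solution of `δ(Q′_kλ)δ_{k,Ax}(A + ∂λ)`, (5.1.13)).
[cite: BalabanImbrieJaffe1985, (5.1.13) p.315] -/
theorem lam_add_grad {grad : ES →ₗ[ℝ] EA} (Ax : Submodule ℝ EA) (lam : EA →ₗ[ℝ] ES)
    (hlamQ : ∀ A : EA, D.Qp (lam A) = 0) (hlamAx : ∀ A : EA, A + grad (lam A) ∈ Ax)
    (hlamU : ∀ (A : EA) (μ : ES), D.Qp μ = 0 → A + grad μ ∈ Ax → μ = lam A)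
    (X : EA) {μ : ES} (hμ : D.Qp μ = 0) : lam (X + grad μ) = lam X - μ := by
  symm
  apply hlamU
  · rw [map_sub, hlamQ, hμ, sub_zero]
  · have : X + grad μ + grad (lam X - μ) = X + grad (lam X) := by rw [map_sub]; abel
    rw [this]
    exact hlamAx X

omit [FiniteDimensional ℝ EA] [MeasurableSpace EA] [BorelSpace EA] [FiniteDimensional ℝ ES] [MeasurableSpace ES] [BorelSpace ES] in
/-- **`∫dλ δ(Q′_kλ)δ_{k,Ax}(A + ∂λ)(A + ∂λ)` evaluates to the axial representative, which is gauge invariant along `N(Q′)`**: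
`(X + ∂μ) + ∂λ(X + ∂μ) = X + ∂λ(X)` for `μ ∈ N(Q′)` (the evaluation *"Using this value of λ = λ(A), we have … (A + ∂λ(A))"*, p. 314).
[cite: BalabanImbrieJaffe1985, (5.1.9) p.314] -/
theorem axialRep_add_grad {grad : ES →ₗ[ℝ] EA} (Ax : Submodule ℝ EA) (lam : EA →ₗ[ℝ] ES)
    (hlamQ : ∀ A : EA, D.Qp (lam A) = 0) (hlamAx : ∀ A : EA, A + grad (lam A) ∈ Ax)
    (hlamU : ∀ (A : EA) (μ : ES), D.Qp μ = 0 → A + grad μ ∈ Ax → μ = lam A)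
    (X : EA) {μ : ES} (hμ : D.Qp μ = 0) : X + grad μ + grad (lam (X + grad μ)) = X + grad (lam X) := by
  rw [lam_add_grad D Ax lam hlamQ hlamAx hlamU X hμ, map_sub]
  abel

omit [FiniteDimensional ℝ EA] [MeasurableSpace EA] [BorelSpace EA] [FiniteDimensional ℝ ES] [MeasurableSpace ES] [BorelSpace ES] in
/-- An axial field is its own representative: `λ(w) = 0` for `w ∈ Ax` (uniqueness with `μ = 0`).
[cite: BalabanImbrieJaffe1985, (5.1.13) p.315] -/
theorem lam_eq_zero_of_mem {grad : ES →ₗ[ℝ] EA} (Ax : Submodule ℝ EA) (lam : EA →ₗ[ℝ] ES)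
    (hlamU : ∀ (A : EA) (μ : ES), D.Qp μ = 0 → A + grad μ ∈ Ax → μ = lam A) {w : EA} (hw : w ∈ Ax) : lam w = 0 :=
  (hlamU w 0 (map_zero _) (by rw [map_zero, add_zero]; exact hw)).symm

/-! ## §3  The Faddeev–Popov change of variables `(A′, λ) ↦ A′ + ∂λ : V × N(Q′) ≅ N(Q_k)` -/

omit [FiniteDimensional ℝ EA] [MeasurableSpace EA] [BorelSpace EA] [FiniteDimensional ℝ ES] [MeasurableSpace ES] [BorelSpace ES] in
/-- **"Making the gauge transformation A → A + ∂λ"** (p. 314): the map `(A′, λ) ↦ A′ + ∂λ` from `(δ(Q_kA)δ_{k,Ax}) × δ(Q′_kλ)`, i.e.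
`V × N(Q′)`, to `δ(Q_kA)`, i.e. `N(Q_k)`, is a LINEAR ISOMORPHISM — injective by the uniqueness of the gauge function (5.1.13), onto
because every `A` with `Q_kA = 0` is `(A + ∂λ(A)) + ∂(−λ(A))` with `A + ∂λ(A)` axial (*"using Q_kA → Q_kA + Q_k∂λ = Q_kA + ∂Q′_kλ =
Q_kA"*). [cite: BalabanImbrieJaffe1985, (5.1.8) p.314] -/
theorem exists_fpEquiv {grad : ES →ₗ[ℝ] EA} (hg : D.GaugeStructure grad) {Ax V : Submodule ℝ EA}
    (hV : ∀ A : EA, A ∈ V ↔ D.Qk A = 0 ∧ A ∈ Ax) (lam : EA →ₗ[ℝ] ES)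
    (hlamQ : ∀ A : EA, D.Qp (lam A) = 0) (hlamAx : ∀ A : EA, A + grad (lam A) ∈ Ax)
    (hlamU : ∀ (A : EA) (μ : ES), D.Qp μ = 0 → A + grad μ ∈ Ax → μ = lam A) :
    ∃ Φ : (V × D.kerQp) ≃ₗ[ℝ] D.kerQk, ∀ p : V × D.kerQp, ((Φ p : D.kerQk) : EA) = (p.1 : EA) + grad (p.2 : ES) := by
  let Φ₀ : (V × D.kerQp) →ₗ[ℝ] EA :=
    V.subtype ∘ₗ LinearMap.fst ℝ V D.kerQp + grad ∘ₗ D.kerQp.subtype ∘ₗ LinearMap.snd ℝ V D.kerQp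
  have hΦ₀ : ∀ p : V × D.kerQp, Φ₀ p = (p.1 : EA) + grad (p.2 : ES) := fun p => rfl
  have hmem : ∀ p : V × D.kerQp, Φ₀ p ∈ D.kerQk := by
    intro p
    rw [hΦ₀, D.mem_kerQk, map_add, ((hV _).1 p.1.2).1, hg.Qk_grad _ ((D.mem_kerQp).mp p.2.2), add_zero]
  let Φ₁ : (V × D.kerQp) →ₗ[ℝ] D.kerQk := LinearMap.codRestrict D.kerQk Φ₀ hmem
  have hΦ₁ : ∀ p : V × D.kerQp, ((Φ₁ p : D.kerQk) : EA) = (p.1 : EA) + grad (p.2 : ES) := fun p => rfl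
  have hinj : Function.Injective Φ₁ := by
    intro p q hpq
    have h : ((Φ₁ p : D.kerQk) : EA) = ((Φ₁ q : D.kerQk) : EA) := by rw [hpq]
    rw [hΦ₁, hΦ₁] at h
    -- `(p.1 - q.1) + grad (p.2 - q.2) = 0` with `p.1 - q.1 ∈ Ax`, `p.2 - q.2 ∈ N(Q′)`
    have hw : ((p.1 - q.1 : V) : EA) ∈ Ax := ((hV _).1 (p.1 - q.1).2).2
    have hμ : D.Qp ((q.2 - p.2 : D.kerQp) : ES) = 0 := (D.mem_kerQp).mp (q.2 - p.2).2
    have hzero : (0 : EA) + grad ((q.2 - p.2 : D.kerQp) : ES) ∈ Ax := by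
      have e : (0 : EA) + grad ((q.2 - p.2 : D.kerQp) : ES) = ((p.1 - q.1 : V) : EA) := by
        simp only [Submodule.coe_sub, map_sub, zero_add]
        rw [sub_eq_sub_iff_add_eq_add, add_comm, h]
      rw [e]; exact hw
    have h2 := hlamU 0 _ hμ hzero
    rw [map_zero] at h2
    have hq2 : p.2 = q.2 := by
      have : (q.2 - p.2 : D.kerQp) = 0 := Subtype.ext h2
      exact (sub_eq_zero.mp this).symm
    have hq1 : p.1 = q.1 := by
      apply Subtype.ext
      have := h
      rw [hq2] at this
      exact add_right_cancel this
    exact Prod.ext hq1 hq2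
  have hsurj : Function.Surjective Φ₁ := by
    intro v
    have hvQ : D.Qk (v : EA) = 0 := (D.mem_kerQk).mp v.2
    obtain ⟨hQ, hAx⟩ := exists_axial_rep D hg Ax lam hlamQ hlamAx hvQ
    refine ⟨(⟨(v : EA) + grad (lam (v : EA)), (hV _).2 ⟨hQ, hAx⟩⟩, ⟨-lam (v : EA), ?_⟩), ?_⟩
    · rw [D.mem_kerQp, map_neg, hlamQ, neg_zero]
    · apply Subtype.ext
      rw [hΦ₁]
      simp only [map_neg]
      abel
  exact ⟨LinearEquiv.ofBijective Φ₁ ⟨hinj, hsurj⟩, fun p => hΦ₁ p⟩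

/-- Haar-measure uniqueness: a linear isomorphism onto `N(Q_k)` pushes the product Lebesgue measure of `V × N(Q′)` to a positive
multiple of the Lebesgue measure of `N(Q_k)` (the constant Jacobian of the δ-function normalizations). [folklore] -/
private theorem exists_map_eq_smul (V : Submodule ℝ EA) (Φ : (V × D.kerQp) ≃ₗ[ℝ] D.kerQk) :
    ∃ c : ℝ≥0, 0 < c ∧ (volume : Measure (V × D.kerQp)).map Φ = c • (volume : Measure D.kerQk) := by
  haveI : (volume : Measure (V × D.kerQp)).IsAddHaarMeasure := by
    rw [Measure.volume_eq_prod]; infer_instance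
  haveI : ((volume : Measure (V × D.kerQp)).map Φ).IsAddHaarMeasure := Measure.MapLinearEquiv.isAddHaarMeasure _ Φ
  exact ⟨_, Measure.addHaarScalarFactor_pos_of_isAddHaarMeasure _ _, Measure.isAddLeftInvariant_eq_smul _ _⟩

/-- the change of variables for one integrand, given the isomorphism and its Haar constant. [folklore] -/
private theorem integral_comp_equiv {X : Type*} [NormedAddCommGroup X] [NormedSpace ℝ X]
    (V : Submodule ℝ EA) (Φ : (V × D.kerQp) ≃ₗ[ℝ] D.kerQk) {c : ℝ≥0}
    (hc : (volume : Measure (V × D.kerQp)).map Φ = c • (volume : Measure D.kerQk))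
    (g : D.kerQk → X) (hg : Integrable g) :
    ∫ w : V, ∫ μ : D.kerQp, g (Φ (w, μ)) = (c : ℝ) • ∫ v : D.kerQk, g v := by
  have hme : MeasurableEmbedding (fun p : V × D.kerQp => Φ p) :=
    Φ.toContinuousLinearEquiv.toHomeomorph.measurableEmbedding
  have h1 : ∫ p : V × D.kerQp, g (Φ p) = (c : ℝ) • ∫ v : D.kerQk, g v := by
    rw [← hme.integral_map, hc, integral_smul_nnreal_measure]
    rfl
  have hint : Integrable (fun p : V × D.kerQp => g (Φ p)) (volume : Measure (V × D.kerQp)) := by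
    have h := (hme.integrable_map_iff (μ := (volume : Measure (V × D.kerQp))) (g := g)).1
    rw [hc] at h
    exact h hg.smul_measure_nnreal
  rw [← h1]
  exact (integral_prod (fun p : V × D.kerQp => g (Φ p)) hint).symm

/-- **The Faddeev–Popov change of variables** behind (5.1.8)–(5.1.9): there is ONE constant `c > 0` (the Jacobian of the
δ-function normalizations; B-independent — the printed `Z_k⁻¹`) such that for every base point `A₁` and every integrand `g` which is
integrable over the fibre, `∫_{N(Q_k)} g(A₁ + v)dv = c·∫_V∫_{N(Q′)} g(A₁ + w + ∂μ)dμ dw` — stated for real integrands (partition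
functions) and for field-valued integrands (means). [cite: BalabanImbrieJaffe1985, (5.1.8) p.314] -/
theorem fp_change_of_variables {grad : ES →ₗ[ℝ] EA} (hg : D.GaugeStructure grad) {Ax V : Submodule ℝ EA}
    (hV : ∀ A : EA, A ∈ V ↔ D.Qk A = 0 ∧ A ∈ Ax) (lam : EA →ₗ[ℝ] ES)
    (hlamQ : ∀ A : EA, D.Qp (lam A) = 0) (hlamAx : ∀ A : EA, A + grad (lam A) ∈ Ax)
    (hlamU : ∀ (A : EA) (μ : ES), D.Qp μ = 0 → A + grad μ ∈ Ax → μ = lam A) :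
    ∃ c : ℝ, 0 < c ∧
      (∀ (A₁ : EA) (g : EA → ℝ), Integrable (fun v : D.kerQk => g (A₁ + (v : EA))) →
        ∫ v : D.kerQk, g (A₁ + (v : EA)) = c * ∫ w : V, ∫ μ : D.kerQp, g (A₁ + (w : EA) + grad (μ : ES))) ∧
      (∀ (A₁ : EA) (g : EA → EA), Integrable (fun v : D.kerQk => g (A₁ + (v : EA))) →
        ∫ v : D.kerQk, g (A₁ + (v : EA)) = c • ∫ w : V, ∫ μ : D.kerQp, g (A₁ + (w : EA) + grad (μ : ES))) := by
  obtain ⟨Φ, hΦ⟩ := exists_fpEquiv D hg hV lam hlamQ hlamAx hlamU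
  obtain ⟨c, hc, hmap⟩ := exists_map_eq_smul D V Φ
  have hc' : (0 : ℝ) < ((c : ℝ≥0) : ℝ)⁻¹ := inv_pos.mpr (NNReal.coe_pos.mpr hc)
  refine ⟨((c : ℝ))⁻¹, hc', fun A₁ g hint => ?_, fun A₁ g hint => ?_⟩
  · have h := integral_comp_equiv D V Φ hmap (fun v : D.kerQk => g (A₁ + (v : EA))) hint
    simp only [hΦ, ← add_assoc] at h
    rw [h, smul_eq_mul, ← mul_assoc, inv_mul_cancel₀ (NNReal.coe_pos.mpr hc).ne', one_mul]
  · have h := integral_comp_equiv D V Φ hmap (fun v : D.kerQk => g (A₁ + (v : EA))) hint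
    simp only [hΦ, ← add_assoc] at h
    rw [h, smul_smul, inv_mul_cancel₀ (NNReal.coe_pos.mpr hc).ne', one_smul]

/-! ## §4  Integrability of the Landau-gauge Gaussian integrands over the fibre (base point `H_kB`) -/

/-- the map `A ↦ (∂A, R∂*A)` into the `L²`-product, whose squared norm is `2E(A)`. [folklore] -/
private def Tmap : EA →ₗ[ℝ] WithLp 2 (EP × ES) where
  toFun A := WithLp.toLp 2 (D.curl A, D.projR (D.dstar A))
  map_add' A A' := by
    rw [← WithLp.toLp_add, Prod.mk_add_mk, ← map_add, ← map_add, ← map_add]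
  map_smul' t A := by
    rw [RingHom.id_apply, ← WithLp.toLp_smul, Prod.smul_mk, ← map_smul, ← map_smul, ← map_smul]

omit [FiniteDimensional ℝ EA] [MeasurableSpace EA] [BorelSpace EA] [MeasurableSpace ES] [BorelSpace ES] in
/-- unfolding `Tmap`. [folklore] -/
private theorem Tmap_apply (A : EA) : Tmap D A = WithLp.toLp 2 (D.curl A, D.projR (D.dstar A)) := rfl

omit [FiniteDimensional ℝ EA] [MeasurableSpace EA] [BorelSpace EA] [MeasurableSpace ES] [BorelSpace ES] in
/-- `−½‖(∂A, R∂*A)‖² = −E(A)`. [folklore] -/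
private theorem neg_half_norm_Tmap_sq (A : EA) : -(1 / 2 : ℝ) * ‖Tmap D A‖ ^ 2 = -D.energy A := by
  rw [Tmap_apply, WithLp.prod_norm_sq_eq_of_L2, WithLp.toLp_fst, WithLp.toLp_snd, LandauOps.energy]
  ring

omit [FiniteDimensional ℝ EA] [MeasurableSpace EA] [BorelSpace EA] [MeasurableSpace ES] [BorelSpace ES] in
/-- no zero modes ⇒ `A ↦ (∂A, R∂*A)` is injective on `N(Q_k)`. [folklore] -/
private theorem Tmap_injOn (hZ : ∀ v : EA, D.Qk v = 0 → D.curl v = 0 → D.projR (D.dstar v) = 0 → v = 0)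
    (v : D.kerQk) (hv : Tmap D (v : EA) = 0) : v = 0 := by
  have h1 : D.curl (v : EA) = 0 := by
    have := congrArg WithLp.fst hv
    rwa [Tmap_apply, WithLp.toLp_fst, WithLp.zero_fst] at this
  have h2 : D.projR (D.dstar (v : EA)) = 0 := by
    have := congrArg WithLp.snd hv
    rwa [Tmap_apply, WithLp.toLp_snd, WithLp.zero_snd] at this
  exact Subtype.ext (hZ _ ((D.mem_kerQk).mp v.2) h1 h2)

/-- **integrability of the (4.4.3) integrand over the fibre**, read at the base point `H_kB`: `v ↦ 𝒢(∂*(H + v))e^{−½‖∂(H + v)‖²}` is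
integrable over `N(Q_k)` (splitting `E(H_kB + v) = E(H_kB) + E(v)` at the minimizer, Gaussian domination by no zero modes).
[cite: BalabanImbrieJaffe1985, (4.4.3) p.312] -/
theorem integrable_weight_fibre (hZ : ∀ v : EA, D.Qk v = 0 → D.curl v = 0 → D.projR (D.dstar v) = 0 → v = 0)
    (hL : ∀ l : ES, D.Qp l = 0 → D.lap l = 0 → l = 0) {B : EB} (hB : ∃ A, D.Qk A = B) :
    Integrable (fun v : D.kerQk => weight D (Hk D B + (v : EA))) := by
  obtain ⟨hQ, hmin, -, -⟩ := Hk_spec D hZ hL hB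
  have hpt : ∀ v : D.kerQk, weight D (Hk D B + (v : EA)) =
      ((cR D)⁻¹ * Real.exp (-D.energy (Hk D B))) * Real.exp (-(1 / 2) * ‖(Tmap D ∘ₗ D.kerQk.subtype) v‖ ^ 2) := by
    intro v
    rw [weight_eq, D.energy_split_of_isMinOn hQ hmin ((D.mem_kerQk).mp v.2), neg_add, Real.exp_add, LinearMap.comp_apply,
      Submodule.subtype_apply, neg_half_norm_Tmap_sq]
    ring
  simp_rw [hpt]
  have hinj : Function.Injective (Tmap D ∘ₗ D.kerQk.subtype) := by
    intro v w h
    have : (Tmap D ∘ₗ D.kerQk.subtype) (v - w) = 0 := by rw [map_sub, h, sub_self]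
    exact sub_eq_zero.mp (Tmap_injOn D hZ _ this)
  exact (partition_integrable hinj).const_mul _

/-- **integrability of the (4.4.2)/(5.1.9) integrand over the fibre**: for any continuous linear `L` (here `A ↦ A + ∂λ(A)`),
`v ↦ 𝒢(∂*(H + v))e^{−½‖∂(H + v)‖²}·L(H + v)` is Bochner-integrable over `N(Q_k)` at the base point `H = H_kB` (first Gaussian moment,
p09's `moment_integrable`). [cite: BalabanImbrieJaffe1985, (5.1.9) p.314] -/
theorem integrable_weight_smul_fibre (hZ : ∀ v : EA, D.Qk v = 0 → D.curl v = 0 → D.projR (D.dstar v) = 0 → v = 0)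
    (hL : ∀ l : ES, D.Qp l = 0 → D.lap l = 0 → l = 0) {B : EB} (hB : ∃ A, D.Qk A = B) (L : EA →ₗ[ℝ] EA) :
    Integrable (fun v : D.kerQk => weight D (Hk D B + (v : EA)) • L (Hk D B + (v : EA))) := by
  obtain ⟨hQ, hmin, -, -⟩ := Hk_spec D hZ hL hB
  set H := Hk D B with hH
  set κ : ℝ := (cR D)⁻¹ * Real.exp (-D.energy H) with hκ
  have hpt : ∀ v : D.kerQk, weight D (H + (v : EA)) • L (H + (v : EA)) =
      κ • (Real.exp (-(1 / 2) * ‖Tmap D (v : EA)‖ ^ 2) • L H +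
        L.toContinuousLinearMap (Real.exp (-(1 / 2) * ‖Tmap D (v : EA)‖ ^ 2) • (v : EA))) := by
    intro v
    rw [weight_eq, D.energy_split_of_isMinOn hQ hmin ((D.mem_kerQk).mp v.2), neg_add, Real.exp_add, neg_half_norm_Tmap_sq,
      LinearMap.coe_toContinuousLinearMap', map_smul, map_add, hκ]
    module
  simp_rw [hpt]
  have hD : ∀ v : D.kerQk, Tmap D (v : EA) = 0 → v = 0 := Tmap_injOn D hZ
  have hinj : Function.Injective (Tmap D ∘ₗ D.kerQk.subtype) := by
    intro v w h
    have : (Tmap D ∘ₗ D.kerQk.subtype) (v - w) = 0 := by rw [map_sub, h, sub_self]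
    exact sub_eq_zero.mp (hD _ this)
  have h1 : Integrable (fun v : D.kerQk => Real.exp (-(1 / 2) * ‖Tmap D (v : EA)‖ ^ 2) • L H) :=
    (partition_integrable hinj).smul_const _
  have h2 : Integrable (fun v : D.kerQk =>
      L.toContinuousLinearMap (Real.exp (-(1 / 2) * ‖Tmap D (v : EA)‖ ^ 2) • (v : EA))) :=
    L.toContinuousLinearMap.integrable_comp (moment_integrable hD)
  exact (h1.add h2).smul κ

end

end Literature.MathematicalPhysics.QuantumFieldTheory.BalabanImbrieJaffe1984to88.BIJ85FaddeevPopov518
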